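import Mathlib
import Literature.Probability.RandomPlanarGeometry.FreelyJointedSAW
import Literature.Probability.RandomPlanarGeometry.LoopSpaceMaps
import Literature.Probability.RandomPlanarGeometry.ChordalCurveFamily
import HarnessLib

/-!
# Euclidean and scaling covariance of the critical freely-jointed chain

Topic `Literature/Probability/RandomPlanarGeometry`; theorems only, continuing
`FreelyJointedSAW.lean` (definition request `FreelyJointedSAW.law`, route `SAWIsotropicAnchor`).
The two-point law `FreelyJointedSAW.law ℓ Ω x y` of the critical freely-jointed non-crossing chain
is EXACTLY covariant, at every step length `ℓ`, under the rigid motions of the plane and under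
dilations (the step length is the only scale):

* `law_map_similarity` — for every similarity `φ(z) = c z + w`, `c ≠ 0` (the tree's
  `similarity c hc w`, as in `ChordalFamily.IsSimilarityCovariant`):
  `law (‖c‖ ℓ) (φΩ) (φx) (φy) = φ_* law ℓ Ω x y`; corollaries `law_map_similarity_of_norm_eq_one`
  (rigid motions: exact symmetry at the SAME step length) and `law_map_dilation` (the scaling
  orbit `ℓ ↦ r ℓ`);
* `law_map_conj` — reflection: `law ℓ (conj Ω) (conj x) (conj y) = conj_* law ℓ Ω x y`, with
  `conj` as `Complex.conjLIE.toHomeomorph` (the form used by the route's `RStarRot`).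

Both are instances of one transport lemma (`weight_transport`, `law_transport`): a measurable map
`G` of configuration space with `configMeasure ℓ' x' N = κ • G_* configMeasure ℓ x N`,
intertwining the configuration-to-curve maps (`chainCurve ℓ' N ∘ G = Φ ∘ chainCurve ℓ N`) and
whose curve-space map `Φ` pulls the conditioning event back (`preimage_map_admissible`),
transports `weight` with the factor `κ` and `law` exactly (the factor cancels in the
normalisation; `κ = ‖c‖²`, the Lebesgue measure of the starting ball, `map_volume_similarity`).
The configuration maps are: the similarity on the starting point together with the cell-wise
shift `θ ↦ θ + α (mod 2π)` of every angle, `α = arg c (mod 2π)` (a measure-preserving bijection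
of `[0, 2π)`, `map_restrict_angleShift`); complex conjugation together with `θ ↦ 2π - θ`
(`map_restrict_angleRefl`). On curve space `Φ = CurveClass.map φ`, and polylines are equivariant
under real-affine maps (`Polyline.polyline_map_apply`, `FreelyJointedSAW.curveOf_comp_affine`);
simplicity of classes is invariant under homeomorphisms (`map_mem_simple_iff`).

Lawler–Schramm–Werner 2004, §3.4.3: "the scaling laws tell us that these relations hold for the
maps `z ↦ rz`"; here, off lattice, rotations are exact as well (the point of the isotropic
regularisation). All statements are elementary changes of variables; tagged [folklore] unless
they restate the LSW covariance shape.

## References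

* G. F. Lawler, O. Schramm, W. Werner, *On the scaling limit of planar self-avoiding walk* (2004),
  §3.4.2–§3.4.3. [LawlerSchrammWerner2004SAW]
-/

noncomputable section

open MeasureTheory Set Filter Function
open scoped ENNReal NNReal unitInterval Topology Real

namespace Literature.Probability.RandomPlanarGeometry

/-! ### Polylines are equivariant under real-affine maps -/

namespace Polyline

open Literature.Probability.LatticeModels (polyline polylineFrom)

variable {E F : Type*} [AddCommGroup E] [Module ℝ E] [TopologicalSpace E] [ContinuousAdd E]
  [ContinuousSMul ℝ E] [AddCommGroup F] [Module ℝ F] [TopologicalSpace F] [ContinuousAdd F]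
  [ContinuousSMul ℝ F]

/-- The dyadic polyline through the images of the vertices under a real-affine map is the image
of the polyline (segments are mapped to segments with the same affine parametrisation).
[folklore] -/
theorem polylineFrom_map_apply (f : E →ᵃ[ℝ] F) :
    ∀ (l : List E) (a : E) (t : I), (polylineFrom (f a) (l.map f)).2 t = f ((polylineFrom a l).2 t)
  | [], _, _ => rfl
  | b :: l, a, t => by
      change ((Path.segment (f a) (f b)).trans (polylineFrom (f b) (l.map f)).2) t =
        f (((Path.segment a b).trans (polylineFrom b l).2) t)
      rw [path_trans_apply_ite, path_trans_apply_ite]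
      have ht0 := t.2.1
      have ht1 := t.2.2
      split_ifs with h
      · rw [Path.extend_apply _ ⟨by linarith, by linarith⟩, Path.extend_apply _ ⟨by linarith, by linarith⟩,
          Path.segment_apply, Path.segment_apply, AffineMap.apply_lineMap]
      · rw [Path.extend_apply _ ⟨by linarith, by linarith⟩, Path.extend_apply _ ⟨by linarith, by linarith⟩]
        exact polylineFrom_map_apply f l b _

/-- `polyline (l.map f) = f ∘ polyline l` for a nonempty vertex list and a real-affine `f`.
[folklore] -/
theorem polyline_map_apply (f : E →ᵃ[ℝ] F) (a : E) (l : List E) (t : I) :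
    polyline ((a :: l).map f) t = f (polyline (a :: l) t) :=
  polylineFrom_map_apply f l a t

end Polyline

namespace FreelyJointedSAW

/-- The polyline class through the images of the vertices under a continuous map `F` of the
plane that is (pointwise) real-affine is the push-forward of the polyline class along `F`.
[folklore] -/
theorem curveOf_comp_affine (f : ℂ →ᵃ[ℝ] ℂ) (F : C(ℂ, ℂ)) (hF : ∀ z, F z = f z) (N : ℕ)
    (v : Fin (N + 1) → ℂ) : curveOf N (fun k => F (v k)) = (curveOf N v).map F := by
  unfold curveOf
  rw [CurveClass.map_mk]
  congr 1
  ext t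
  change LatticeModels.polyline (List.ofFn fun k => F (v k)) t =
    F (LatticeModels.polyline (List.ofFn v) t)
  simp_rw [hF]
  rw [show (List.ofFn fun k => f (v k)) = (List.ofFn v).map f from (List.map_ofFn ..).symm,
    List.ofFn_succ]
  exact Polyline.polyline_map_apply f _ _ t

/-! ### Simple classes and the conditioning event under plane isometries and dilations -/

/-- Push-forward along an injective continuous map preserves simplicity of curve classes.
[folklore] -/
theorem map_mem_simple {E F : Type*} [MetricSpace E] [MetricSpace F] {f : C(E, F)}
    (hf : Injective f) {c : CurveClass E} (hc : c ∈ CurveClass.simple) :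
    c.map f ∈ (CurveClass.simple : Set (CurveClass F)) := by
  obtain ⟨γ, hγ, rfl⟩ := hc
  rw [CurveClass.map_mk]
  exact CurveClass.mk_mem_simple (hf.comp hγ)

/-- For a continuous map with a continuous left inverse, a class is simple iff its push-forward
is. [folklore] -/
theorem map_mem_simple_iff {E F : Type*} [MetricSpace E] [MetricSpace F] {f : C(E, F)} {g : C(F, E)}
    (hgf : ∀ x, g (f x) = x) {c : CurveClass E} :
    c.map f ∈ (CurveClass.simple : Set (CurveClass F)) ↔ c ∈ CurveClass.simple := by
  refine ⟨fun h => ?_, map_mem_simple (LeftInverse.injective hgf)⟩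
  have hinj : Injective (g ∘ f) := fun a b hab => by simpa [hgf] using hab
  have hg : InjOn g (Set.range f) := by
    rintro _ ⟨a, rfl⟩ _ ⟨b, rfl⟩ h
    rw [hgf, hgf] at h
    rw [h]
  have key : (c.map f).map g = c := by
    rw [CurveClass.map_map]
    have : g.comp f = ContinuousMap.id E := by ext x; exact hgf x
    rw [this, CurveClass.map_id]
  obtain ⟨γ, hγ, hγc⟩ := h
  rw [← key, ← hγc, CurveClass.map_mk]
  refine CurveClass.mk_mem_simple fun a b hab => hγ (hg ?_ ?_ hab)
  · have : Curve.range γ = (c.map f).range := by rw [← hγc]; rfl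
    have hr : Curve.range γ ⊆ Set.range f := by
      rw [this, CurveClass.range_map]
      rintro _ ⟨z, -, rfl⟩
      exact ⟨z, rfl⟩
    exact hr ⟨a, rfl⟩
  · have : Curve.range γ = (c.map f).range := by rw [← hγc]; rfl
    have hr : Curve.range γ ⊆ Set.range f := by
      rw [this, CurveClass.range_map]
      rintro _ ⟨z, -, rfl⟩
      exact ⟨z, rfl⟩
    exact hr ⟨b, rfl⟩

/-- **The conditioning event is equivariant under plane similarities**: for a homeomorphism `φ`
of the plane scaling distances by `r > 0`, a curve is admissible for `(r ℓ, φΩ, φy)` iff its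
preimage curve is admissible for `(ℓ, Ω, y)`. [folklore] -/
theorem preimage_map_admissible (φ : ℂ ≃ₜ ℂ) {r : ℝ} (hr : 0 < r)
    (hφ : ∀ a b, dist (φ a) (φ b) = r * dist a b) (ℓ : ℝ) (Ω : Set ℂ) (y : ℂ) :
    CurveClass.map (φ : C(ℂ, ℂ)) ⁻¹' admissible (r * ℓ) (φ '' Ω) (φ y) = admissible ℓ Ω y := by
  ext c
  simp only [admissible, mem_preimage, mem_setOf_eq, CurveClass.range_map, CurveClass.target_map]
  have h1 : c.map (φ : C(ℂ, ℂ)) ∈ CurveClass.simple ↔ c ∈ CurveClass.simple :=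
    map_mem_simple_iff (f := (φ : C(ℂ, ℂ))) (g := (φ.symm : C(ℂ, ℂ))) (fun x => φ.symm_apply_apply x)
  have h2 : (φ : C(ℂ, ℂ)) '' c.range ⊆ closure (φ '' Ω) ↔ c.range ⊆ closure Ω := by
    change φ '' c.range ⊆ closure (φ '' Ω) ↔ _
    rw [← φ.image_closure]
    exact Set.image_subset_image_iff φ.injective
  have h3 : (φ : C(ℂ, ℂ)) c.target ∈ Metric.ball (φ y) (r * ℓ) ↔ c.target ∈ Metric.ball y ℓ := by
    change φ c.target ∈ Metric.ball (φ y) (r * ℓ) ↔ _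
    rw [Metric.mem_ball, Metric.mem_ball, hφ]
    exact mul_lt_mul_iff_of_pos_left hr
  rw [h1, h2, h3]

/-! ### Transport of `weight` and `law` along a symmetry of configuration space -/

/-- The set identity behind the transport lemma: pulling the conditioned event back through an
intertwining configuration map. [folklore] -/
theorem preimage_transport {ℓ ℓ' : ℝ} {Ω Ω' : Set ℂ} {y y' : ℂ} {N : ℕ}
    {Φ : CurveClass ℂ → CurveClass ℂ} {G : ℂ × (Fin N → ℝ) → ℂ × (Fin N → ℝ)}
    (hV : ∀ p, chainCurve ℓ' N (G p) = Φ (chainCurve ℓ N p))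
    (hE : Φ ⁻¹' admissible ℓ' Ω' y' = admissible ℓ Ω y) (s : Set (CurveClass ℂ)) :
    G ⁻¹' (chainCurve ℓ' N ⁻¹' s ∩ chainCurve ℓ' N ⁻¹' admissible ℓ' Ω' y') =
      chainCurve ℓ N ⁻¹' (Φ ⁻¹' s) ∩ chainCurve ℓ N ⁻¹' admissible ℓ Ω y := by
  ext p
  simp only [mem_preimage, mem_inter_iff, hV]
  rw [← hE, mem_preimage]

/-- **Transport of the unnormalised measure.** If a measurable map `G` of configuration space
pushes `configMeasure ℓ x N` to `κ⁻¹ • configMeasure ℓ' x' N` (i.e.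
`configMeasure ℓ' x' N = κ • G_* configMeasure ℓ x N`) for every `N`, intertwines the
configuration-to-curve maps through a measurable map `Φ` of curve space, and `Φ` pulls the
conditioning event of `(ℓ', Ω', y')` back to that of `(ℓ, Ω, y)`, then
`weight ℓ' Ω' x' y' = κ • Φ_* weight ℓ Ω x y`. [folklore] -/
theorem weight_transport {ℓ ℓ' : ℝ} {Ω Ω' : Set ℂ} {x x' y y' : ℂ} {κ : ℝ≥0∞}
    {Φ : CurveClass ℂ → CurveClass ℂ} (hΦ : Measurable Φ)
    {G : ∀ N : ℕ, ℂ × (Fin N → ℝ) → ℂ × (Fin N → ℝ)} (hG : ∀ N, Measurable (G N))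
    (hρ : ∀ N, configMeasure ℓ' x' N = κ • (configMeasure ℓ x N).map (G N))
    (hV : ∀ N p, chainCurve ℓ' N (G N p) = Φ (chainCurve ℓ N p))
    (hE : Φ ⁻¹' admissible ℓ' Ω' y' = admissible ℓ Ω y) :
    weight ℓ' Ω' x' y' = κ • (weight ℓ Ω x y).map Φ := by
  ext s hs
  rw [weight_apply _ _ _ _ hs, Measure.smul_apply, Measure.map_apply hΦ hs,
    weight_apply _ _ _ _ (hΦ hs), smul_eq_mul, ← ENNReal.tsum_mul_left]
  refine tsum_congr fun N => ?_
  have hmeas : MeasurableSet (chainCurve ℓ' N ⁻¹' s ∩ chainCurve ℓ' N ⁻¹' admissible ℓ' Ω' y') :=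
    (measurable_chainCurve ℓ' N hs).inter (measurableSet_preimage_admissible ℓ' Ω' y' N)
  rw [hρ N, Measure.smul_apply, Measure.map_apply (hG N) hmeas, preimage_transport (hV N) hE,
    smul_eq_mul]
  ring

/-- **Transport of the law.** Under the hypotheses of `weight_transport` with `0 < κ < ∞`, the
normalised laws are EXACTLY intertwined: `law ℓ' Ω' x' y' = Φ_* law ℓ Ω x y` (the factor `κ`
cancels in the normalisation; both sides are `0` in the junk cases). [folklore] -/
theorem law_transport {ℓ ℓ' : ℝ} {Ω Ω' : Set ℂ} {x x' y y' : ℂ} {κ : ℝ≥0∞} (hκ0 : κ ≠ 0)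
    (hκt : κ ≠ ∞) {Φ : CurveClass ℂ → CurveClass ℂ} (hΦ : Measurable Φ)
    {G : ∀ N : ℕ, ℂ × (Fin N → ℝ) → ℂ × (Fin N → ℝ)} (hG : ∀ N, Measurable (G N))
    (hρ : ∀ N, configMeasure ℓ' x' N = κ • (configMeasure ℓ x N).map (G N))
    (hV : ∀ N p, chainCurve ℓ' N (G N p) = Φ (chainCurve ℓ N p))
    (hE : Φ ⁻¹' admissible ℓ' Ω' y' = admissible ℓ Ω y) :
    law ℓ' Ω' x' y' = (law ℓ Ω x y).map Φ := by
  rw [law, law, weight_transport hΦ hG hρ hV hE, Measure.map_smul, Measure.smul_apply,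
    Measure.map_apply hΦ MeasurableSet.univ, preimage_univ, smul_eq_mul, smul_smul]
  congr 1
  rw [ENNReal.mul_inv (Or.inl hκ0) (Or.inl hκt), mul_comm κ⁻¹, mul_assoc,
    ENNReal.inv_mul_cancel hκ0 hκt, mul_one]

/-! ### Symmetries of the angle box `[0, 2π)^N` -/

/-- **The cell-wise angle shift preserves Haar measure on `[0, 2π)`**: for `α ∈ [0, 2π)` the
bijection `θ ↦ θ + α (mod 2π)` of `[0, 2π)` — in two pieces, `θ ↦ θ + α` on `[0, 2π - α)` and
`θ ↦ θ + α - 2π` on `[2π - α, 2π)` — preserves restricted Lebesgue measure. [folklore] -/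
theorem map_restrict_angleShift {α : ℝ} (hα : α ∈ Set.Ico 0 (2 * π)) :
    (volume.restrict (Set.Ico 0 (2 * π))).map
        (fun θ : ℝ => if θ < 2 * π - α then θ + α else θ + α - 2 * π) =
      volume.restrict (Set.Ico 0 (2 * π)) := by
  set g : ℝ → ℝ := fun θ => if θ < 2 * π - α then θ + α else θ + α - 2 * π with hg_def
  have hg : Measurable g :=
    Measurable.ite measurableSet_Iio (measurable_id.add_const _)
      ((measurable_id.add_const _).sub_const _)
  ext B hB
  rw [Measure.map_apply hg hB, Measure.restrict_apply (hg hB), Measure.restrict_apply hB]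
  have hsplit : g ⁻¹' B ∩ Set.Ico 0 (2 * π) =
      ((fun θ => θ + α) ⁻¹' (B ∩ Set.Ico α (2 * π))) ∪
        ((fun θ => θ + (α - 2 * π)) ⁻¹' (B ∩ Set.Ico 0 α)) := by
    ext θ
    simp only [hg_def, mem_inter_iff, mem_preimage, mem_union, mem_Ico]
    constructor
    · rintro ⟨hθB, h0, h1⟩
      by_cases h : θ < 2 * π - α
      · rw [if_pos h] at hθB
        exact Or.inl ⟨hθB, by linarith [hα.1], by linarith⟩
      · rw [if_neg h] at hθB
        refine Or.inr ⟨by rwa [← add_sub_assoc], by linarith [not_lt.1 h], by linarith⟩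
    · rintro (⟨hθB, h0, h1⟩ | ⟨hθB, h0, h1⟩)
      · have h : θ < 2 * π - α := by linarith
        rw [if_pos h]
        exact ⟨hθB, by linarith [hα.1], by linarith [hα.1]⟩
      · have h : ¬ θ < 2 * π - α := by
          intro h
          linarith [hα.2]
        rw [if_neg h, ← add_sub_assoc] at *
        refine ⟨hθB, by linarith [hα.2], by linarith⟩
  have hdisj : Disjoint ((fun θ => θ + α) ⁻¹' (B ∩ Set.Ico α (2 * π)))
      ((fun θ => θ + (α - 2 * π)) ⁻¹' (B ∩ Set.Ico 0 α)) := by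
    rw [Set.disjoint_left]
    rintro θ ⟨-, -, h1⟩ ⟨-, h2, -⟩
    dsimp only at h1 h2
    linarith
  rw [hsplit, measure_union hdisj ((hB.inter measurableSet_Ico).preimage (measurable_add_const _)),
    measure_preimage_add_right, measure_preimage_add_right,
    ← measure_union _ (hB.inter measurableSet_Ico)]
  · congr 1
    rw [← Set.inter_union_distrib_left, Set.union_comm,
      Set.Ico_union_Ico_eq_Ico hα.1 hα.2.le]
  · exact Disjoint.mono inter_subset_right inter_subset_right
      (Set.disjoint_left.2 fun θ h1 h2 => by linarith [h1.1, h2.2])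

/-- **Angle reversal preserves Haar measure on `[0, 2π)`**: `θ ↦ 2π - θ` maps `[0, 2π)` onto
`(0, 2π]`, which carries the same restricted Lebesgue measure. [folklore] -/
theorem map_restrict_angleRefl :
    (volume.restrict (Set.Ico 0 (2 * π))).map (fun θ : ℝ => 2 * π - θ) =
      volume.restrict (Set.Ico 0 (2 * π)) := by
  have he : MeasurableEmbedding fun θ : ℝ => 2 * π - θ :=
    (MeasurableEquiv.subLeft (2 * π)).measurableEmbedding
  have hpre : (fun θ : ℝ => 2 * π - θ) ⁻¹' Set.Ioc 0 (2 * π) = Set.Ico 0 (2 * π) := by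
    ext θ
    simp only [mem_preimage, mem_Ioc, mem_Ico]
    constructor <;> rintro ⟨h1, h2⟩ <;> constructor <;> linarith
  calc (volume.restrict (Set.Ico 0 (2 * π))).map (fun θ : ℝ => 2 * π - θ)
      = ((volume : Measure ℝ).map (fun θ : ℝ => 2 * π - θ)).restrict (Set.Ioc 0 (2 * π)) := by
        rw [he.restrict_map, hpre]
    _ = volume.restrict (Set.Ioc 0 (2 * π)) := by
        rw [(Measure.measurePreserving_sub_left volume (2 * π)).map_eq]
    _ = volume.restrict (Set.Ico 0 (2 * π)) := (Measure.restrict_congr_set Ico_ae_eq_Ioc).symm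

/-- A coordinatewise map preserving Haar measure on `[0, 2π)` preserves Haar measure on the
angle box `[0, 2π)^N`. [folklore] -/
theorem map_restrict_angleBox {f : ℝ → ℝ} (hf : Measurable f)
    (hmap : (volume.restrict (Set.Ico 0 (2 * π))).map f = volume.restrict (Set.Ico 0 (2 * π)))
    (N : ℕ) :
    (volume.restrict (Set.univ.pi fun _ : Fin N => Set.Ico (0 : ℝ) (2 * π))).map
        (fun θ j => f (θ j)) =
      volume.restrict (Set.univ.pi fun _ : Fin N => Set.Ico (0 : ℝ) (2 * π)) := by
  rw [volume_pi, Measure.restrict_pi_pi]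
  exact (measurePreserving_pi (fun _ : Fin N => (volume : Measure ℝ).restrict (Set.Ico 0 (2 * π)))
    (fun _ => (volume : Measure ℝ).restrict (Set.Ico 0 (2 * π))) fun _ => ⟨hf, hmap⟩).map_eq

/-- The shifted angle has the rotated direction: `e^{i g_α(θ)} = e^{iα} e^{iθ}`. [folklore] -/
theorem exp_angleShift (α θ : ℝ) :
    Complex.exp (Complex.I * ((if θ < 2 * π - α then θ + α else θ + α - 2 * π : ℝ) : ℂ)) =
      Complex.exp (Complex.I * α) * Complex.exp (Complex.I * θ) := by
  split_ifs
  · push_cast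
    rw [← Complex.exp_add]
    ring_nf
  · push_cast
    rw [show Complex.I * (θ + α - 2 * π) = (Complex.I * α + Complex.I * θ) - 2 * π * Complex.I by
      ring, Complex.exp_sub, Complex.exp_two_pi_mul_I, div_one, Complex.exp_add]

/-- The reversed angle has the conjugate direction: `e^{i(2π - θ)} = conj e^{iθ}`. [folklore] -/
theorem exp_angleRefl (θ : ℝ) :
    Complex.exp (Complex.I * ((2 * π - θ : ℝ) : ℂ)) =
      (starRingEnd ℂ) (Complex.exp (Complex.I * θ)) := by
  rw [← Complex.exp_conj, map_mul, Complex.conj_I, Complex.conj_ofReal]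
  push_cast
  rw [show Complex.I * (2 * π - θ) = -Complex.I * θ + 2 * π * Complex.I by ring, Complex.exp_add,
    Complex.exp_two_pi_mul_I, mul_one]

/-! ### Lebesgue measure of the plane under similarities -/

/-- A similarity `z ↦ c z + w` scales distances by `‖c‖`. [folklore] -/
theorem dist_similarity (c : ℂ) (hc : c ≠ 0) (w a b : ℂ) :
    dist (similarity c hc w a) (similarity c hc w b) = ‖c‖ * dist a b := by
  rw [similarity_apply, similarity_apply, dist_add_right, dist_eq_norm, dist_eq_norm, ← mul_sub,
    norm_mul]

/-- The preimage of a ball under a similarity. [folklore] -/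
theorem preimage_similarity_ball (c : ℂ) (hc : c ≠ 0) (w x : ℂ) (ℓ : ℝ) :
    similarity c hc w ⁻¹' Metric.ball (similarity c hc w x) (‖c‖ * ℓ) = Metric.ball x ℓ := by
  ext z
  rw [mem_preimage, Metric.mem_ball, Metric.mem_ball, dist_similarity]
  exact mul_lt_mul_iff_of_pos_left (norm_pos_iff.2 hc)

/-- **Lebesgue measure of the plane under a similarity**: `(c · + w)_* Leb = ‖c‖⁻² Leb`
(rotation part measure-preserving, dilation part by `Measure.map_addHaar_smul`, translation
invariance). [folklore] -/
theorem map_volume_similarity (c : ℂ) (hc : c ≠ 0) (w : ℂ) :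
    (volume : Measure ℂ).map (similarity c hc w) = ENNReal.ofReal ((‖c‖ ^ 2)⁻¹) • volume := by
  set u : Circle := Circle.exp (Complex.arg c) with hu
  have hcu : (‖c‖ : ℂ) * (u : ℂ) = c := by
    rw [hu, Circle.coe_exp]
    exact_mod_cast Complex.norm_mul_exp_arg_mul_I c
  have h1 : (similarity c hc w : ℂ → ℂ) = (fun z : ℂ => z + w) ∘ (fun z : ℂ => (‖c‖ : ℝ) • z) ∘
      (rotation u : ℂ → ℂ) := by
    funext z
    simp only [comp_apply, similarity_apply, rotation_apply, Complex.real_smul]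
    rw [← mul_assoc, hcu]
  have hnorm : (‖c‖ : ℝ) ≠ 0 := norm_ne_zero_iff.2 hc
  rw [h1, ← Measure.map_map (measurable_add_const w) ((measurable_const_smul _).comp
      (rotation u).continuous.measurable),
    ← Measure.map_map (measurable_const_smul _) (rotation u).continuous.measurable,
    (rotation u).measurePreserving.map_eq, Measure.map_addHaar_smul volume hnorm,
    Complex.finrank_real_complex, Measure.map_smul, map_add_right_eq_self, abs_of_pos]
  positivity

/-- **The starting ball transforms with the factor `‖c‖²`**:
`(c · + w)_* Leb|_{B(x,ℓ)} = ‖c‖⁻² Leb|_{B(cx+w, ‖c‖ℓ)}`. [folklore] -/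
theorem map_restrict_ball_similarity (c : ℂ) (hc : c ≠ 0) (w x : ℂ) (ℓ : ℝ) :
    ((volume : Measure ℂ).restrict (Metric.ball x ℓ)).map (similarity c hc w) =
      ENNReal.ofReal ((‖c‖ ^ 2)⁻¹) •
        volume.restrict (Metric.ball (similarity c hc w x) (‖c‖ * ℓ)) := by
  have he : MeasurableEmbedding (similarity c hc w) := (similarity c hc w).measurableEmbedding
  rw [← preimage_similarity_ball c hc w x ℓ, ← he.restrict_map, map_volume_similarity,
    Measure.restrict_smul]

/-! ### Covariance of the law under similarities and reflections -/

/-- The configuration map of a similarity: transform the starting point by the similarity and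
shift every angle by `α` cell-wise (bookkeeping for `law_map_similarity`; `α ∈ [0, 2π)` is the
reduced argument of `c`). Measurability. [folklore] -/
theorem measurable_configMap_similarity (c : ℂ) (hc : c ≠ 0) (w : ℂ) (α : ℝ) (N : ℕ) :
    Measurable fun p : ℂ × (Fin N → ℝ) =>
      (similarity c hc w p.1, fun j => if p.2 j < 2 * π - α then p.2 j + α else p.2 j + α - 2 * π) := by
  refine Measurable.prodMk ((similarity c hc w).continuous.measurable.comp measurable_fst)
    (measurable_pi_lambda _ fun j => ?_)
  have hg : Measurable fun θ : ℝ => if θ < 2 * π - α then θ + α else θ + α - 2 * π :=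
    Measurable.ite measurableSet_Iio (measurable_id.add_const _)
      ((measurable_id.add_const _).sub_const _)
  exact hg.comp ((measurable_pi_apply j).comp measurable_snd)

/-- The unit chain with all angles shifted by `α` (cell-wise) is the unit chain rotated by `α`.
[folklore] -/
theorem steps_angleShift (α : ℝ) {N : ℕ} (θ : Fin N → ℝ) (k : Fin (N + 1)) :
    steps N (fun j => if θ j < 2 * π - α then θ j + α else θ j + α - 2 * π) k =
      Complex.exp (Complex.I * α) * steps N θ k := by
  unfold steps
  rw [Finset.mul_sum]
  refine Finset.sum_congr rfl fun j _ => ?_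
  split_ifs with h
  · exact exp_angleShift α (θ j)
  · rw [mul_zero]

/-- The unit chain with all angles reversed is the complex conjugate of the unit chain.
[folklore] -/
theorem steps_angleRefl {N : ℕ} (θ : Fin N → ℝ) (k : Fin (N + 1)) :
    steps N (fun j => 2 * π - θ j) k = (starRingEnd ℂ) (steps N θ k) := by
  unfold steps
  rw [map_sum]
  refine Finset.sum_congr rfl fun j _ => ?_
  split_ifs with h
  · exact exp_angleRefl (θ j)
  · rw [map_zero]

/-- **Exact similarity covariance of the critical freely-jointed chain.** For every similarity
`φ(z) = c z + w` (`c ≠ 0`: rotation by `arg c`, dilation by `‖c‖`, translation by `w`) and every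
step length `ℓ`, `law (‖c‖ ℓ) (φΩ) (φx) (φy) = φ_* law ℓ Ω x y` — translations and rotations are
exact symmetries at fixed step length, and dilations move along the scaling orbit `ℓ ↦ ‖c‖ ℓ`
(LSW 2004, §3.4.3: covariance under `z ↦ rz` from the scaling laws; here also exactly isotropic).
[cite: LawlerSchrammWerner2004SAW, §3.4.3] -/
theorem law_map_similarity (c : ℂ) (hc : c ≠ 0) (w : ℂ) (ℓ : ℝ) (Ω : Set ℂ) (x y : ℂ) :
    law (‖c‖ * ℓ) (similarity c hc w '' Ω) (similarity c hc w x) (similarity c hc w y) =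
      (law ℓ Ω x y).map (CurveClass.map (similarity c hc w : C(ℂ, ℂ))) := by
  -- the reduced argument `α ∈ [0, 2π)` of `c`, `‖c‖ e^{iα} = c`
  set α : ℝ := toIcoMod Real.two_pi_pos 0 (Complex.arg c) with hα_def
  have hα : α ∈ Set.Ico 0 (2 * π) := by
    have := toIcoMod_mem_Ico Real.two_pi_pos 0 (Complex.arg c)
    rwa [zero_add] at this
  have hexpα : Complex.exp (Complex.I * α) = Complex.exp (Complex.arg c * Complex.I) := by
    rw [hα_def, ← self_sub_toIcoDiv_zsmul Real.two_pi_pos 0 (Complex.arg c), zsmul_eq_mul]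
    push_cast
    rw [show Complex.I * (Complex.arg c - (toIcoDiv Real.two_pi_pos 0 (Complex.arg c) : ℂ) *
        (2 * π)) = Complex.arg c * Complex.I +
          (-(toIcoDiv Real.two_pi_pos 0 (Complex.arg c)) : ℤ) * (2 * π * Complex.I) by
        push_cast; ring, Complex.exp_add, Complex.exp_int_mul_two_pi_mul_I, mul_one]
  have hcα : (‖c‖ : ℂ) * Complex.exp (Complex.I * α) = c := by
    rw [hexpα]
    exact_mod_cast Complex.norm_mul_exp_arg_mul_I c
  have hκ0 : ENNReal.ofReal (‖c‖ ^ 2) ≠ 0 := by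
    rw [ENNReal.ofReal_ne_zero_iff]
    exact pow_pos (norm_pos_iff.2 hc) 2
  -- the affine form of the similarity, for the polyline equivariance
  let f : ℂ →ᵃ[ℝ] ℂ := ⟨fun z => c * z + w, LinearMap.mul ℝ ℂ c, fun p v => by
    simp only [LinearMap.mul_apply_apply, vadd_eq_add]; ring⟩
  refine law_transport (κ := ENNReal.ofReal (‖c‖ ^ 2)) hκ0 ENNReal.ofReal_ne_top
    (measurable_curveClassMap_similarity c hc w)
    (G := fun N p => (similarity c hc w p.1,
      fun j => if p.2 j < 2 * π - α then p.2 j + α else p.2 j + α - 2 * π))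
    (fun N => measurable_configMap_similarity c hc w α N) (fun N => ?_) (fun N p => ?_)
    (preimage_map_admissible (similarity c hc w) (norm_pos_iff.2 hc) (dist_similarity c hc w) ℓ Ω y)
  · -- the configuration measures
    have hg : Measurable fun θ : ℝ => if θ < 2 * π - α then θ + α else θ + α - 2 * π :=
      Measurable.ite measurableSet_Iio (measurable_id.add_const _)
        ((measurable_id.add_const _).sub_const _)
    have hS : Measurable fun θ : Fin N → ℝ => fun j =>
        if θ j < 2 * π - α then θ j + α else θ j + α - 2 * π :=
      measurable_pi_lambda _ fun j => hg.comp (measurable_pi_apply j)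
    rw [configMeasure, configMeasure,
      show (fun p : ℂ × (Fin N → ℝ) => (similarity c hc w p.1,
          fun j => if p.2 j < 2 * π - α then p.2 j + α else p.2 j + α - 2 * π)) =
        Prod.map (similarity c hc w)
          (fun θ : Fin N → ℝ => fun j => if θ j < 2 * π - α then θ j + α else θ j + α - 2 * π)
        from rfl,
      ← Measure.map_prod_map _ _ (similarity c hc w).continuous.measurable hS,
      map_restrict_angleBox hg (map_restrict_angleShift hα) N, map_restrict_ball_similarity,
      Measure.prod_smul_left, smul_smul, ← ENNReal.ofReal_mul (by positivity),
      mul_inv_cancel₀ (by positivity), ENNReal.ofReal_one, one_smul]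
  · -- the configuration-to-curve maps are intertwined
    change curveOf N (fun k => similarity c hc w p.1 + ((‖c‖ * ℓ : ℝ) : ℂ) *
        steps N (fun j => if p.2 j < 2 * π - α then p.2 j + α else p.2 j + α - 2 * π) k) =
      CurveClass.map (similarity c hc w : C(ℂ, ℂ)) (curveOf N fun k => p.1 + (ℓ : ℂ) * steps N p.2 k)
    rw [← curveOf_comp_affine f (similarity c hc w : C(ℂ, ℂ)) (fun z => rfl)]
    congr 1
    funext k
    rw [steps_angleShift, similarity_apply]
    change c * p.1 + w + ((‖c‖ * ℓ : ℝ) : ℂ) * (Complex.exp (Complex.I * α) * steps N p.2 k) =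
      c * (p.1 + (ℓ : ℂ) * steps N p.2 k) + w
    push_cast
    linear_combination ((ℓ : ℂ) * steps N p.2 k) * hcα

/-- **Exact reflection covariance of the critical freely-jointed chain**: complex conjugation
(with the angles reversed, `θ ↦ 2π - θ`) is a symmetry of the configuration measure, so
`law ℓ (conj Ω) (conj x) (conj y) = conj_* law ℓ Ω x y` at every step length. [folklore] -/
theorem law_map_conj (ℓ : ℝ) (Ω : Set ℂ) (x y : ℂ) :
    law ℓ (Complex.conjLIE.toHomeomorph '' Ω) (Complex.conjLIE.toHomeomorph x)
        (Complex.conjLIE.toHomeomorph y) =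
      (law ℓ Ω x y).map (CurveClass.map (Complex.conjLIE.toHomeomorph : C(ℂ, ℂ))) := by
  set φ : ℂ ≃ₜ ℂ := Complex.conjLIE.toHomeomorph with hφ
  have hφz : ∀ z, φ z = (starRingEnd ℂ) z := fun z => rfl
  have hdist : ∀ a b, dist (φ a) (φ b) = 1 * dist a b := fun a b => by
    rw [hφz, hφz, Complex.dist_conj_conj, one_mul]
  have hΦ : Measurable (CurveClass.map (φ : C(ℂ, ℂ))) :=
    (CurveClass.lipschitzWith_map (K := 1) (LipschitzWith.of_dist_le_mul fun a b => by
      change dist (φ a) (φ b) ≤ _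
      rw [hdist, NNReal.coe_one])).continuous.measurable
  have hE := preimage_map_admissible φ zero_lt_one hdist ℓ Ω y
  rw [one_mul] at hE
  let f : ℂ →ᵃ[ℝ] ℂ := Complex.conjAe.toLinearMap.toAffineMap
  have hf : ∀ z, (φ : C(ℂ, ℂ)) z = f z := fun z => rfl
  have hrefl : Measurable fun θ : ℝ => 2 * π - θ := measurable_const.sub measurable_id
  refine law_transport (κ := 1) one_ne_zero ENNReal.one_ne_top hΦ
    (G := fun N p => (φ p.1, fun j => 2 * π - p.2 j))
    (fun N => Measurable.prodMk (φ.continuous.measurable.comp measurable_fst)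
      (measurable_pi_lambda _ fun j => hrefl.comp ((measurable_pi_apply j).comp measurable_snd)))
    (fun N => ?_) (fun N p => ?_) hE
  · have hS : Measurable fun θ : Fin N → ℝ => fun j => 2 * π - θ j :=
      measurable_pi_lambda _ fun j => hrefl.comp (measurable_pi_apply j)
    rw [configMeasure, configMeasure, one_smul,
      show (fun p : ℂ × (Fin N → ℝ) => (φ p.1, fun j => 2 * π - p.2 j)) =
        Prod.map φ (fun θ : Fin N → ℝ => fun j => 2 * π - θ j) from rfl,
      ← Measure.map_prod_map _ _ φ.continuous.measurable hS,
      map_restrict_angleBox hrefl map_restrict_angleRefl N]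
    congr 1
    have he : MeasurableEmbedding φ := φ.measurableEmbedding
    have hpre : φ ⁻¹' Metric.ball (φ x) ℓ = Metric.ball x ℓ := by
      ext z
      rw [mem_preimage, Metric.mem_ball, Metric.mem_ball, hdist, one_mul]
    rw [← hpre, ← he.restrict_map]
    congr 1
    exact (Complex.conjLIE.measurePreserving.map_eq).symm
  · change curveOf N (fun k => φ p.1 + (ℓ : ℂ) * steps N (fun j => 2 * π - p.2 j) k) =
      CurveClass.map (φ : C(ℂ, ℂ)) (curveOf N fun k => p.1 + (ℓ : ℂ) * steps N p.2 k)
    rw [← curveOf_comp_affine f (φ : C(ℂ, ℂ)) hf]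
    congr 1
    funext k
    rw [steps_angleRefl, hf, hφz]
    change _ = (starRingEnd ℂ) (p.1 + (ℓ : ℂ) * steps N p.2 k)
    rw [map_add, map_mul, Complex.conj_ofReal]

/-- **Rigid motions are exact symmetries at fixed step length**: for `‖c‖ = 1` (rotation by
`arg c` followed by translation by `w`), `law ℓ (φΩ) (φx) (φy) = φ_* law ℓ Ω x y`. [folklore] -/
theorem law_map_similarity_of_norm_eq_one (c : ℂ) (hc : c ≠ 0) (hc1 : ‖c‖ = 1) (w : ℂ) (ℓ : ℝ)
    (Ω : Set ℂ) (x y : ℂ) :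
    law ℓ (similarity c hc w '' Ω) (similarity c hc w x) (similarity c hc w y) =
      (law ℓ Ω x y).map (CurveClass.map (similarity c hc w : C(ℂ, ℂ))) := by
  have h := law_map_similarity c hc w ℓ Ω x y
  rwa [hc1, one_mul] at h

/-- **The scaling orbit**: for `r > 0`, `law (r ℓ) (rΩ) (r x) (r y) = (r ·)_* law ℓ Ω x y` — the
step length is the only scale of the model (LSW 2004, §3.4.3, the maps `z ↦ rz`).
[cite: LawlerSchrammWerner2004SAW, §3.4.3] -/
theorem law_map_dilation (r : ℝ) (hr : 0 < r) (ℓ : ℝ) (Ω : Set ℂ) (x y : ℂ) :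
    law (r * ℓ) (similarity (r : ℂ) (by exact_mod_cast hr.ne') 0 '' Ω)
        (similarity (r : ℂ) (by exact_mod_cast hr.ne') 0 x)
        (similarity (r : ℂ) (by exact_mod_cast hr.ne') 0 y) =
      (law ℓ Ω x y).map
        (CurveClass.map (similarity (r : ℂ) (by exact_mod_cast hr.ne') 0 : C(ℂ, ℂ))) := by
  have h := law_map_similarity (r : ℂ) (by exact_mod_cast hr.ne') 0 ℓ Ω x y
  rwa [Complex.norm_real, Real.norm_of_nonneg hr.le] at h

end FreelyJointedSAW

end Literature.Probability.RandomPlanarGeometry
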